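import Literature.MathematicalPhysics.QuantumLattice.TypeClassSidecarReaderTTPrime
import Literature.MathematicalPhysics.QuantumLattice.HubbardTTPrimePressureFloorUTransport
import HarnessLib

/-!
# «c2-sector» sidecar readers on a `U`-BOX: the cap below the sidecar's `U` is free, the cap above it is
# priced by a thermal docc word the sidecar produces itself (with a `T = 0` energy floor to its left)

Family `hubbard` (topic `MathematicalPhysics/QuantumLattice`), seat hubbard-downfold-unc-1 (stage S1 → S2 of the
Hubbard material-oracle programme: «monotonicity/Lipschitz of certified words in `(t′, U, μ)` so a parameter BOX maps
to a certified word», the `U` direction). The temperature-axis CAPS of the cuprate box produced by hubbard-thermal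
from a checked «c2-sector» sidecar ALONE (`TypeClassSidecarReaderTTPrime`,
`IsTorusLimitOfMixture.meanEnergy_hubbardTTPrime_le_of_c2Check_infT_allTori`: `e_Φ(ω) ≤ (s − W)/β`, the chord between
the certified pressure floor `W` at `β` and the exact sector entropy `s` at `β = 0`) are stated at the sidecar's own
coupling `U₀`. This file words them on a `U`-interval:

* §1 the CLAIM NODE moves DOWN in `U` for free (`c2node_of_le_U`): the open-box canonical partition functions are
  antitone in `U` (`openBox_partitionFn_floor_of_le_U`), so the rows certified at `U₀` are rows at every `U ≤ U₀`;
* §2 hence the C2-only cap `(s − W)/β` holds for EVERY torus limit at EVERY `U ≤ U₀`, no price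
  (`…le_of_c2Check_infT_allTori_of_le_U`, `…_seven_eighths_of_le_U`) — the infinite-temperature anchor is `U`-free;
  the certified `W = Wnum/Wden` as an `hW`-shape pressure floor at every `U ≤ U₀` along every sequence of tori
  (`eventually_pressureFloor_of_c2Check_of_le_U`);
* §3 a `T = 0` ENERGY FLOOR is a PRESSURE CEILING at every `β ≥ 0` (`eventually_pressureCeiling_of_energyFloor`:
  `log Z_{L,β} ≤ log #sector_L − β E₀(L)`, `E₀(L)/L² → e(t,t',U,n) ≥ f`, `log #sector_L ≤ s L²` eventually, hence
  `∀ ε > 0, ∀ᶠ j, log Re Z_β ≤ (s − β f + ε) L²` along every `Ls → ∞`);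
* §4 the sidecar PRODUCES ITS OWN DOCC WORD: its floor `W` at `(β, U₀)` and the energy-floor ceiling `s − β f` at
  `(β, U₁)`, `0 ≤ U₁ < U₀`, give the thermal docc cap `D(ω) ≤ (s − β f − W)/(β (U₀ − U₁))` for every torus limit of the
  canonical sector Gibbs states at `(β, t, t', U, n)`, every `U ≥ U₀` (the `U`-chord of
  `HubbardTTPrimePressureFloorUTransport` §7; with the free Fermi-sea floor at `U₁ = 0` this is the first certified
  thermal docc cap available in a box without a Markov producer);
* §5 above the sidecar the cap is PRICED: `e_Φ(ω) ≤ (s − W)/β + (U − U₀)·A` at every `U ≥ U₀` with any thermal docc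
  ceiling word `A` at `(β, U₀)` (`…_of_doccWord_left_U`), the kinematic edition `+ max(U − U₀, 0)·n/2` at every `U`
  (`…_of_anchorU_kinematic`), and the self-priced composition with §4
  (`…_of_energyFloor_left_U`: `A = (s − β f − W)/(β (U₀ − U₁))`);
* §6 the LOWER edge on a `U`-interval from a `T = 0` floor at its LEFT end (`le_meanEnergy_hubbardTTPrime_of_energyFloor_left_U`:
  `f ≤ e(t,t',U₁,n) ≤ e(t,t',U,n) ≤ e_Φ(ω)` for `0 ≤ U₁ ≤ U`);
* §7 the `n = 7/8` editions with the explicit entropy constant `s = 1371/1000` (`2 H_b(7/16) < 1.371`);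
* §8 (appended) `t' = 0`, BOTH certificates at the sidecar's coupling `U₀` (C2 at `(β, U₀)` + C1 rectangle Markov at `(β_h, U₀)`,
  the hubbard-thermal fixed-point cells): the cell at every `U` with kinematic prices (`…_of_c2Check_of_rectMarkovCertificate_allTori_anchorU_kinematic`:
  hot ceiling pays `β_h (U₀ − U) n/2` below, cold floor pays `β (U − U₀) n/2` above), at `U ≥ U₀` with a docc word
  (`…_of_doccWord_left_U`) and self-priced (`…_of_energyFloor_left_U`, `…_seven_eighths_of_energyFloor_left_U`).

So ONE sidecar at the RIGHT end `U₂` of a `U`-box and ONE `T = 0` energy floor at its LEFT end `U₁` word the whole box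
`[U₁, U₂]` at every temperature the sidecar certifies, at zero transport price; a sidecar at an interior point `U₀`
words `[U₁, U₀]` for free and `[U₀, U₂]` at the price `(U − U₀)·(s − β f − W)/(β (U₀ − U₁'))` (`U₁'` any floor node
left of `U₀`; the Fermi sea at `U₁' = 0` is always available).

Everything is PROVED; no definition, no named fact, no number. HONEST SCOPE: the price above the sidecar is first
order in `U − U₀` with a docc word that ignores the thermal entropy deficit at `U₁` (the energy-floor ceiling uses the
full sector entropy `s`); a sidecar certified at the box's right end removes it. WHAT THIS IS NOT: no certificate, no
phase sentence; nothing here moves a word in `β` or `t'`.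

## Mathlib / tree search

REUSED: `IsTorusLimitOfMixture.meanEnergy_hubbardTTPrime_le_of_c2Check_infT_allTori`, `c2Check_sound`,
`c2Floor_le_of_rows` (`TypeClassSidecarReader[TTPrime]`); `openBox_partitionFn_floor_of_le_U`
(`HubbardTTPrimeOpenBoxPartitionFnCouplingTransport`); `eventually_typeFreeEntropy_mul_sq_le_log_partitionFn_allTori_of_le_U`,
`…_of_doccWord_left_U`, `…_of_anchorU_kinematic`, `density_nonneg_of_type`,
`IsTorusLimitOfMixture.meanEnergy_onSite_le_of_pressure_bounds_U_allTori` (`HubbardTTPrimePressureFloorUTransport` §6–§7);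
`IsTorusLimitOfMixture.meanEnergy_hubbardTTPrime_le_entropy_sub_div_of_sectorGibbs`,
`mul_sectorGibbs_meanEnergy_le_log_count_sub_log_partitionFn` (`TorusSectorGibbsEnergyWindow`);
`eventually_log_sectorGibbsCount_le`, `IsTorusLimitOfMixture.energyDensityTT'_le_meanEnergy_of_sectorGibbs`,
`sectorGibbsWeightTT'_nonneg`, `sum_sectorGibbsWeightTT'`, `isNParticle_sectorGibbsVectorTT'`,
`star_sectorGibbsVectorTT'_dotProduct_self` (`TorusSectorGibbsMixture`); `tendsto_energyDensityTT'_torus`,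
`energyDensityTT'_mono_U`, `ThermodynamicLimit.groundEnergy_le_re_expect`. `rg '_of_c2Check.*_of_le_U|pressureCeiling_of_energyFloor|
c2node' Literature/MathematicalPhysics/QuantumLattice` (2026-08-27): nothing.

## References

* R. B. Israel, *Convexity in the Theory of Lattice Gases* (1979), Thm. I.3.4 (monotonicity/convexity of the pressure in
  a positive coupling), Lemma II.3.1. [cite: Israel1979, Thm. I.3.4] [cite: Israel1979, Lemma II.3.1]
* E. H. Lieb, Commun. Math. Phys. 31 (1973) 327, §V (5.2)–(5.4) (Peierls–Bogoliubov). [cite: Lieb1973, §V (5.2)–(5.4)]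
* D. Ruelle, *Statistical Mechanics: Rigorous Results* (1969), §2.5–2.6, §3.3–3.4. [cite: Ruelle1969, §3.3]
* S. J. Gustafson, I. M. Sigal, *Mathematical Concepts of Quantum Mechanics*, §18.3 (18.12) (`Z_β ≤ dim·e^{−βE₀}`).
  [cite: GustafsonSigal2003, §18.3]
* T. M. Cover, J. A. Thomas, *Elements of Information Theory* (2006), Theorem 11.1.3. [cite: CoverThomas2006, Theorem 11.1.3]
* T. Koma, H. Tasaki, J. Stat. Phys. 76 (1994) 745, §1. [cite: KomaTasaki1994, §1]
-/

noncomputable section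

namespace Literature.MathematicalPhysics.QuantumLattice

open Matrix Finset HubbardWave0 ThermodynamicLimit LiebThm1 AndersonCluster Literature.Probability.LatticeModels
open _root_.Filter
open scoped _root_.Topology ComplexOrder BigOperators

/-! ### §0 Arithmetic: the sector entropy constant at filling `7/8` -/

/-- `2 log 2 + (log 3)/2 + 1/98 ≤ log 7` (re-derived; private in `TorusSectorGibbsMixture` §6). [folklore] -/
private theorem two_mul_log_two_add_half_log_three_add_inv98_le_log_seven :
    2 * Real.log 2 + Real.log 3 / 2 + 1 / 98 ≤ Real.log 7 := by
  have h49 : Real.log 49 = 2 * Real.log 7 := by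
    rw [show (49 : ℝ) = 7 ^ 2 by norm_num, Real.log_pow]; norm_num
  have h48 : Real.log 48 = 4 * Real.log 2 + Real.log 3 := by
    rw [show (48 : ℝ) = 2 ^ 4 * 3 by norm_num, Real.log_mul (by norm_num) (by norm_num), Real.log_pow]
    norm_num
  have hq : 1 - (49 / 48 : ℝ)⁻¹ ≤ Real.log (49 / 48) := Real.one_sub_inv_le_log_of_pos (by norm_num)
  have hdiv : Real.log (49 / 48) = Real.log 49 - Real.log 48 :=
    Real.log_div (by norm_num) (by norm_num)
  rw [hdiv, h49, h48] at hq
  norm_num at hq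
  linarith

/-- `2·H_b(7/16) < 1371/1000`: the sector-dimension entropy per site at filling `7/8` (`log #sector_L / L² →
2 H_b(n/2)`) is below `1.371` (re-derived; private in `TorusSectorGibbsMixture` §6 and `TypeClassSidecarReaderTTPrime`).
[folklore] -/
private theorem two_mul_binEntropy_seven_sixteenths_lt :
    2 * Real.binEntropy (7 / 8 / 2) < 1371 / 1000 := by
  rw [show (7 / 8 / 2 : ℝ) = 7 / 16 by norm_num]
  have hid : 2 * Real.binEntropy (7 / 16) =
      8 * Real.log 2 - 7 / 8 * Real.log 7 - 9 / 4 * Real.log 3 := by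
    have h16 : Real.log 16 = 4 * Real.log 2 := by
      rw [show (16 : ℝ) = 2 ^ 4 by norm_num, Real.log_pow]; norm_num
    have h9 : Real.log 9 = 2 * Real.log 3 := by
      rw [show (9 : ℝ) = 3 ^ 2 by norm_num, Real.log_pow]; norm_num
    rw [Real.binEntropy, show (1 - 7 / 16 : ℝ) = 9 / 16 by norm_num, inv_div, inv_div,
      Real.log_div (by norm_num) (by norm_num), Real.log_div (by norm_num) (by norm_num), h16, h9]
    ring
  rw [hid]
  linarith [Real.log_two_lt_d9, Real.log_three_gt_d9,
    two_mul_log_two_add_half_log_three_add_inv98_le_log_seven]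

/-! ### §1 The claim node of a sidecar moves DOWN in `U` for free -/

section Node

variable {a b : ℕ}

/-- **The sidecar's claim node moves down in `U` at no price.** If every row's floor is certified at `U₀`,
`zn_r/2^ze_r ≤ Re Z_β(H^open_{a×b}(t,t',U₀); N↑_r, N↓_r)`, then the same rows are certified at every `U ≤ U₀`
(`β ≥ 0`; the open-box canonical partition functions are antitone in `U`). [cite: Israel1979, Thm. I.3.4] -/
theorem c2node_of_le_U (t t' : ℝ) {β : ℝ} (hβ : 0 ≤ β) {U U₀ : ℝ} (hU : U ≤ U₀) {rows : List C2Row}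
    (hnode : ∀ r ∈ rows,
      r.floor ≤ (partitionFn β (spinSectorHamiltonian r.nu r.nd (hubbardOpenBoxTT' a b t t' U₀))).re) :
    ∀ r ∈ rows, r.floor ≤ (partitionFn β (spinSectorHamiltonian r.nu r.nd (hubbardOpenBoxTT' a b t t' U))).re :=
  fun r hr => openBox_partitionFn_floor_of_le_U a b r.nu r.nd t t' hβ hU (hnode r hr)

end Node

namespace InfVolFermionState

variable {t t' U n β : ℝ} {ω : InfVolFermionState 2} {Ls : ℕ → ℕ}

/-! ### §2 The C2-only cap on the whole half-line `U ≤ U₀`, no price -/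

/-- **The C2-only temperature-axis cap holds at every `U` BELOW the sidecar's coupling, no price.** `ω` a torus
limit of the canonical sector Gibbs states at `(β, t, t', U, n)` along any `Ls → ∞` (`β > 0`, `0 ≤ n ≤ 2`), `U ≤ U₀`;
sidecar `rows` for the open `a × b` box at `(β, t, t', U₀)` passing `c2Check …` with density `n (q a b) = 2 A₀` and its
claim node AT `U₀`; `s > 2 H_b(n/2)`. Then `e_Φ(t,t',U)(ω) ≤ (s − Wnum/Wden)/β`.
[cite: Israel1979, Lemma II.3.1] [cite: Israel1979, Thm. I.3.4] [cite: Ruelle1969, §3.3] -/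
theorem IsTorusLimitOfMixture.meanEnergy_hubbardTTPrime_le_of_c2Check_infT_allTori_of_le_U
    (hn0 : 0 ≤ n) (hn2 : n ≤ 2) {U₀ : ℝ} (hU : U ≤ U₀)
    (h : ω.IsTorusLimitOfMixture (sectorGibbsCount n) (fun L => sectorGibbsWeightTT' β t t' U n L)
      (fun L => sectorGibbsVectorTT' t t' U n L) Ls)
    (hLs : Tendsto Ls atTop atTop) (hβ : 0 < β)
    {a b : ℕ} (ha : 1 ≤ a) (hb : 1 ≤ b) {rows : List C2Row} {P K q A₀ : ℕ} {Wnum : ℤ} {Wden : ℕ}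
    (hcheck : c2Check P K q A₀ a b rows Wnum Wden = true) (hn : n * ((q : ℝ) * a * b) = 2 * A₀)
    (hnode : ∀ r ∈ rows,
      r.floor ≤ (partitionFn β (spinSectorHamiltonian r.nu r.nd (hubbardOpenBoxTT' a b t t' U₀))).re)
    {s : ℝ} (hs : 2 * Real.binEntropy (n / 2) < s) :
    ω.meanEnergy (hubbardTTPrimeFermionInteraction t t' U) 1 ≤ (s - (Wnum : ℝ) / Wden) / β :=
  h.meanEnergy_hubbardTTPrime_le_of_c2Check_infT_allTori hn0 hn2 hLs hβ ha hb hcheck hn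
    (c2node_of_le_U t t' hβ.le hU hnode) hs

/-- **At filling `7/8`**: `e_Φ(t,t',U)(ω) ≤ (1371/1000 − Wnum/Wden)/β` for every torus limit at `(β, t, t', U, 7/8)`,
every `U ≤ U₀`, from the sidecar certified at `U₀`. [cite: Israel1979, Lemma II.3.1] [cite: Israel1979, Thm. I.3.4] -/
theorem IsTorusLimitOfMixture.meanEnergy_hubbardTTPrime_le_of_c2Check_infT_seven_eighths_of_le_U {U₀ : ℝ}
    (hU : U ≤ U₀)
    (h : ω.IsTorusLimitOfMixture (sectorGibbsCount (7 / 8)) (fun L => sectorGibbsWeightTT' β t t' U (7 / 8) L)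
      (fun L => sectorGibbsVectorTT' t t' U (7 / 8) L) Ls)
    (hLs : Tendsto Ls atTop atTop) (hβ : 0 < β)
    {a b : ℕ} (ha : 1 ≤ a) (hb : 1 ≤ b) {rows : List C2Row} {P K q A₀ : ℕ} {Wnum : ℤ} {Wden : ℕ}
    (hcheck : c2Check P K q A₀ a b rows Wnum Wden = true) (hn : (7 / 8 : ℝ) * ((q : ℝ) * a * b) = 2 * A₀)
    (hnode : ∀ r ∈ rows,
      r.floor ≤ (partitionFn β (spinSectorHamiltonian r.nu r.nd (hubbardOpenBoxTT' a b t t' U₀))).re) :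
    ω.meanEnergy (hubbardTTPrimeFermionInteraction t t' U) 1 ≤ (1371 / 1000 - (Wnum : ℝ) / Wden) / β :=
  h.meanEnergy_hubbardTTPrime_le_of_c2Check_infT_allTori_of_le_U (by norm_num) (by norm_num) hU hLs hβ ha hb
    hcheck hn hnode two_mul_binEntropy_seven_sixteenths_lt

/-- **The certified `W = Wnum/Wden` of a checked sidecar at `U₀` is an `hW`-shape pressure floor at every `U ≤ U₀`
along every sequence of tori** (`β ≥ 0`): `∀ᶠ j, (Wnum/Wden − ε)(Ls j)² ≤ log Re Z_β(H_{Ls j}(t,t',U)|_sector)`.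
[cite: Ruelle1969, §3.3] [cite: CoverThomas2006, Theorem 11.1.3] [cite: Israel1979, Thm. I.3.4] -/
theorem eventually_pressureFloor_of_c2Check_of_le_U (t t' n : ℝ) {U U₀ : ℝ} (hU : U ≤ U₀) {β : ℝ} (hβ : 0 ≤ β)
    {a b : ℕ} (ha : 1 ≤ a) (hb : 1 ≤ b) {rows : List C2Row} {P K q A₀ : ℕ} {Wnum : ℤ} {Wden : ℕ}
    (hcheck : c2Check P K q A₀ a b rows Wnum Wden = true) (hn : n * ((q : ℝ) * a * b) = 2 * A₀) (hn2 : n ≤ 2)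
    (hnode : ∀ r ∈ rows,
      r.floor ≤ (partitionFn β (spinSectorHamiltonian r.nu r.nd (hubbardOpenBoxTT' a b t t' U₀))).re)
    {Ls : ℕ → ℕ} (hLs : Tendsto Ls atTop atTop) {ε : ℝ} (hε : 0 < ε) :
    ∀ᶠ j in atTop, ((Wnum : ℝ) / Wden - ε) * (Ls j : ℝ) ^ 2 ≤
      Real.log (partitionFn β (sectorHamiltonianTT' t t' U n (Ls j))).re := by
  obtain ⟨hnd, hq, hmS, hsum, hA, hB, hz0, harith⟩ := c2Check_sound hcheck ha hb
  have hz := c2Floor_le_of_rows hnd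
    (F := fun s => (partitionFn β (spinSectorHamiltonian s.1 s.2 (hubbardOpenBoxTT' a b t t' U₀))).re)
    (fun r hr => hnode r hr)
  have hfl := eventually_typeFreeEntropy_mul_sq_le_log_partitionFn_allTori_of_le_U t t' n hU hβ ha hb
    (c2Sectors rows) (c2Type rows) hq hmS hsum hA hB hn hn2 hz0 hz hLs hε
  filter_upwards [hfl] with j hj
  exact le_trans (mul_le_mul_of_nonneg_right (by linarith) (sq_nonneg _)) hj

/-! ### §3 A `T = 0` energy floor is a pressure ceiling at every `β ≥ 0` -/

/-- **ENERGY-FLOOR PRESSURE CEILING.** For `U ≥ 0`, `0 ≤ n < 2`, `β ≥ 0`, a certified `T = 0` floor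
`f ≤ e(t,t',U,n)` and an entropy constant `s > 2 H_b(n/2)`: along every `Ls → ∞`,
`∀ ε > 0, ∀ᶠ j, log Re Z_β(H_{Ls j}(t,t',U)|_sector) ≤ (s − β f + ε)(Ls j)²`
(`Z_β ≤ #sector · e^{−βE₀}`, `E₀(L)/L² → e(t,t',U,n)`, `log #sector_L ≤ s L²` eventually). The `hu`-shape input of the
`U`-chords and temperature chords at ANY coupling carrying a ground-state energy floor — in particular at `U = 0`
(free fermions). [cite: GustafsonSigal2003, §18.3] [cite: Ruelle1969, §3.3] [cite: Israel1979, Lemma II.3.1] -/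
theorem eventually_pressureCeiling_of_energyFloor (hn0 : 0 ≤ n) (hn2 : n < 2) (t t' : ℝ) {U : ℝ} (hU : 0 ≤ U)
    {β : ℝ} (hβ : 0 ≤ β) {f : ℝ} (hf : f ≤ energyDensityTT' t t' U n) {s : ℝ} (hs : 2 * Real.binEntropy (n / 2) < s)
    {Ls : ℕ → ℕ} (hLs : Tendsto Ls atTop atTop) {ε : ℝ} (hε : 0 < ε) :
    ∀ᶠ j in atTop, Real.log (partitionFn β (sectorHamiltonianTT' t t' U n (Ls j))).re ≤
      (s - β * f + ε) * (Ls j : ℝ) ^ 2 := by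
  -- a slack `δ > 0` with `β δ ≤ ε`
  obtain ⟨δ, hδ, hβδ⟩ : ∃ δ : ℝ, 0 < δ ∧ β * δ ≤ ε := by
    refine ⟨ε / (β + 1), by positivity, ?_⟩
    rw [mul_div_assoc', div_le_iff₀ (by linarith)]
    nlinarith
  have hcount := hLs.eventually (eventually_log_sectorGibbsCount_le hn0 hn2.le hs)
  have hgs : ∀ᶠ j in atTop, f - δ <
      groundEnergy (hubbardTorusTT' (Ls j) t t' U) (rectN n (Ls j)) / (Ls j : ℝ) ^ 2 :=
    ((tendsto_energyDensityTT'_torus t t' hU hn0 hn2).comp hLs).eventually (lt_mem_nhds (by linarith))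
  filter_upwards [hcount, hgs, hLs.eventually_ge_atTop 1] with j hcj hgj hj1
  haveI : NeZero (Ls j) := ⟨by omega⟩
  have hL2 : (0 : ℝ) < (Ls j : ℝ) ^ 2 := by positivity
  -- `β · (mean energy) ≤ log #sector − log Z`
  have hchord := mul_sectorGibbs_meanEnergy_le_log_count_sub_log_partitionFn hn0 hn2.le t t' U (Ls j) β
  -- the mean energy of the mixture is at least the sector ground energy
  have hE0 : groundEnergy (hubbardTorusTT' (Ls j) t t' U) (rectN n (Ls j)) ≤
      ∑ i, sectorGibbsWeightTT' β t t' U n (Ls j) i *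
        (QuantumLattice.expect (hubbardTorusTT' (Ls j) t t' U) (sectorGibbsVectorTT' t t' U n (Ls j) i)).re := by
    have hw0 := fun i => sectorGibbsWeightTT'_nonneg β t t' U n (Ls j) i
    have hw1 := sum_sectorGibbsWeightTT' β t t' U hn0 hn2.le (Ls j)
    calc groundEnergy (hubbardTorusTT' (Ls j) t t' U) (rectN n (Ls j))
        = ∑ i, sectorGibbsWeightTT' β t t' U n (Ls j) i *
            groundEnergy (hubbardTorusTT' (Ls j) t t' U) (rectN n (Ls j)) := by
          rw [← Finset.sum_mul, hw1, one_mul]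
      _ ≤ _ := Finset.sum_le_sum fun i _ => mul_le_mul_of_nonneg_left
          (ThermodynamicLimit.groundEnergy_le_re_expect _ (isNParticle_sectorGibbsVectorTT' t t' U n (Ls j) i)
            (star_sectorGibbsVectorTT'_dotProduct_self t t' U n (Ls j) i)) (hw0 i)
  have hgs' : (f - δ) * (Ls j : ℝ) ^ 2 ≤ groundEnergy (hubbardTorusTT' (Ls j) t t' U) (rectN n (Ls j)) := by
    rw [← le_div_iff₀ hL2]; exact hgj.le
  have h1 := mul_le_mul_of_nonneg_left hE0 hβ
  have h2 := mul_le_mul_of_nonneg_left hgs' hβ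
  have h3 := mul_le_mul_of_nonneg_right hβδ hL2.le
  linarith

/-! ### §4 The sidecar produces its own thermal docc word (with a `T = 0` floor to its left) -/

/-- **Thermal docc CAP from the sidecar's floor at `U₀` and a `T = 0` energy floor at `U₁ < U₀`, every torus limit at
every `U ≥ U₀`.** Data: `0 ≤ U₁ < U₀ ≤ U`, `β > 0`, `0 ≤ n < 2`; sidecar `rows` at `(β, t, t', U₀)` passing `c2Check …`
with density `n (q a b) = 2 A₀` and its claim node; `f ≤ e(t,t',U₁,n)`; `s > 2 H_b(n/2)`. Then for every torus limit
`ω` of the canonical sector Gibbs states at `(β, t, t', U, n)` along any `Ls → ∞`: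
`D(ω) = e_{Φ(0,0,1)}(ω) ≤ (s − β f − Wnum/Wden)/(β (U₀ − U₁))` — the lower Peierls–Bogoliubov side of the `U`-chord
between the energy-floor pressure ceiling at `U₁` and the sidecar's floor at `U₀`, moved to `U ≥ U₀` by the
antitonicity of the thermal docc. [cite: Lieb1973, §V (5.2)–(5.4)] [cite: KomaTasaki1994, §1]
[cite: GustafsonSigal2003, §18.3] [cite: Ruelle1969, §3.3] -/
theorem IsTorusLimitOfMixture.meanEnergy_onSite_le_of_c2Check_right_of_energyFloor_left_U_allTori
    (hn0 : 0 ≤ n) (hn2 : n < 2) {U₁ U₀ : ℝ} (hU₁ : 0 ≤ U₁) (hU₁₀ : U₁ < U₀) (hU : U₀ ≤ U) (hβ : 0 < β)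
    {a b : ℕ} (ha : 1 ≤ a) (hb : 1 ≤ b) {rows : List C2Row} {P K q A₀ : ℕ} {Wnum : ℤ} {Wden : ℕ}
    (hcheck : c2Check P K q A₀ a b rows Wnum Wden = true) (hn : n * ((q : ℝ) * a * b) = 2 * A₀)
    (hnode : ∀ r ∈ rows,
      r.floor ≤ (partitionFn β (spinSectorHamiltonian r.nu r.nd (hubbardOpenBoxTT' a b t t' U₀))).re)
    {f : ℝ} (hf : f ≤ energyDensityTT' t t' U₁ n) {s : ℝ} (hs : 2 * Real.binEntropy (n / 2) < s)
    (h : ω.IsTorusLimitOfMixture (sectorGibbsCount n) (fun L => sectorGibbsWeightTT' β t t' U n L)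
      (fun L => sectorGibbsVectorTT' t t' U n L) Ls)
    (hLs : Tendsto Ls atTop atTop) :
    ω.meanEnergy (hubbardTTPrimeFermionInteraction 0 0 1) 1 ≤
      (s - β * f - (Wnum : ℝ) / Wden) / (β * (U₀ - U₁)) :=
  h.meanEnergy_onSite_le_of_pressure_bounds_U_allTori hn0 hn2.le hβ hU₁₀ hU
    (fun _ hLs' _ hε => eventually_pressureCeiling_of_energyFloor hn0 hn2 t t' hU₁ hβ.le hf hs hLs' hε)
    (fun _ hLs' _ hε => eventually_pressureFloor_of_c2Check_of_le_U t t' n le_rfl hβ.le ha hb hcheck hn hn2.le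
      hnode hLs' hε) hLs

/-! ### §5 Above the sidecar: the cap at the price of a docc word -/

/-- **The C2-only cap at every `U` ABOVE the sidecar's coupling, priced by a thermal docc ceiling word at the
sidecar.** `U₀ ≤ U`, `β > 0`, `n ≤ 2`; sidecar at `(β, t, t', U₀)` (check + node + density); a docc ceiling word `A`
valid for every torus limit of the canonical sector Gibbs states at `(β, t, t', U₀, n)` along every `Ls → ∞`;
`s > 2 H_b(n/2)`. Then `e_Φ(t,t',U)(ω) ≤ (s − Wnum/Wden)/β + (U − U₀)·A` for every torus limit at `(β, t, t', U, n)`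
(the pressure floor moves up in `U` by `β (U − U₀) A`, `HubbardTTPrimePressureFloorUTransport` §4/§6).
[cite: Lieb1973, §V (5.2)–(5.4)] [cite: Israel1979, Lemma II.3.1] [cite: Ruelle1969, §3.3] -/
theorem IsTorusLimitOfMixture.meanEnergy_hubbardTTPrime_le_of_c2Check_infT_allTori_of_doccWord_left_U
    (hn2 : n ≤ 2) {U₀ : ℝ} (hU : U₀ ≤ U)
    (h : ω.IsTorusLimitOfMixture (sectorGibbsCount n) (fun L => sectorGibbsWeightTT' β t t' U n L)
      (fun L => sectorGibbsVectorTT' t t' U n L) Ls)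
    (hLs : Tendsto Ls atTop atTop) (hβ : 0 < β)
    {a b : ℕ} (ha : 1 ≤ a) (hb : 1 ≤ b) {rows : List C2Row} {P K q A₀ : ℕ} {Wnum : ℤ} {Wden : ℕ}
    (hcheck : c2Check P K q A₀ a b rows Wnum Wden = true) (hn : n * ((q : ℝ) * a * b) = 2 * A₀)
    (hnode : ∀ r ∈ rows,
      r.floor ≤ (partitionFn β (spinSectorHamiltonian r.nu r.nd (hubbardOpenBoxTT' a b t t' U₀))).re)
    {A : ℝ}
    (hAw : ∀ (ω₁ : InfVolFermionState 2) (Ls₁ : ℕ → ℕ), Tendsto Ls₁ atTop atTop →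
      ω₁.IsTorusLimitOfMixture (sectorGibbsCount n) (fun L => sectorGibbsWeightTT' β t t' U₀ n L)
        (fun L => sectorGibbsVectorTT' t t' U₀ n L) Ls₁ →
      ω₁.meanEnergy (hubbardTTPrimeFermionInteraction 0 0 1) 1 ≤ A)
    {s : ℝ} (hs : 2 * Real.binEntropy (n / 2) < s) :
    ω.meanEnergy (hubbardTTPrimeFermionInteraction t t' U) 1 ≤ (s - (Wnum : ℝ) / Wden) / β + (U - U₀) * A := by
  obtain ⟨hnd, hq, hmS, hsum, hA, hB, hz0, harith⟩ := c2Check_sound hcheck ha hb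
  have hn0 : 0 ≤ n := density_nonneg_of_type ha hb hq hn
  have hz := c2Floor_le_of_rows hnd
    (F := fun s => (partitionFn β (spinSectorHamiltonian s.1 s.2 (hubbardOpenBoxTT' a b t t' U₀))).re)
    (fun r hr => hnode r hr)
  have hcount : ∀ᶠ j in atTop, Real.log (sectorGibbsCount n (Ls j)) ≤ s * (Ls j : ℝ) ^ 2 :=
    hLs.eventually (eventually_log_sectorGibbsCount_le hn0 hn2 hs)
  refine le_of_forall_pos_le_add fun δ hδ => ?_
  have hε : 0 < δ * β := by positivity
  have hfloor : ∀ᶠ j in atTop, ((Wnum : ℝ) / Wden - β * (U - U₀) * A - δ * β) * (Ls j : ℝ) ^ 2 ≤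
      Real.log (partitionFn β (sectorHamiltonianTT' t t' U n (Ls j))).re := by
    have h1 := eventually_typeFreeEntropy_mul_sq_le_log_partitionFn_allTori_of_doccWord_left_U t t' n hU hβ ha hb
      (c2Sectors rows) (c2Type rows) hq hmS hsum hA hB hn hn2 hz0 hz hAw hLs hε
    filter_upwards [h1] with j hj
    exact le_trans (mul_le_mul_of_nonneg_right (by linarith) (sq_nonneg _)) hj
  have h2 := h.meanEnergy_hubbardTTPrime_le_entropy_sub_div_of_sectorGibbs hn0 hn2 hLs hβ hfloor hcount
  have heq : (s - ((Wnum : ℝ) / Wden - β * (U - U₀) * A - δ * β)) / β =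
      (s - (Wnum : ℝ) / Wden) / β + (U - U₀) * A + δ := by
    field_simp
    ring
  rw [heq] at h2
  exact h2

/-- **The C2-only cap at EVERY `U`, kinematic price** (`β > 0`, `n ≤ 2`; sidecar at `(β, t, t', U₀)`):
`e_Φ(t,t',U)(ω) ≤ (s − Wnum/Wden)/β + max(U − U₀, 0)·(n/2)` — free below the sidecar, the kinematic docc bound `n/2`
per site above it. [cite: Lieb1973, §V (5.2)–(5.4)] [cite: Israel1979, Lemma II.3.1] [cite: Israel1979, Thm. I.3.4] -/
theorem IsTorusLimitOfMixture.meanEnergy_hubbardTTPrime_le_of_c2Check_infT_allTori_of_anchorU_kinematic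
    (hn2 : n ≤ 2) (U₀ : ℝ)
    (h : ω.IsTorusLimitOfMixture (sectorGibbsCount n) (fun L => sectorGibbsWeightTT' β t t' U n L)
      (fun L => sectorGibbsVectorTT' t t' U n L) Ls)
    (hLs : Tendsto Ls atTop atTop) (hβ : 0 < β)
    {a b : ℕ} (ha : 1 ≤ a) (hb : 1 ≤ b) {rows : List C2Row} {P K q A₀ : ℕ} {Wnum : ℤ} {Wden : ℕ}
    (hcheck : c2Check P K q A₀ a b rows Wnum Wden = true) (hn : n * ((q : ℝ) * a * b) = 2 * A₀)
    (hnode : ∀ r ∈ rows,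
      r.floor ≤ (partitionFn β (spinSectorHamiltonian r.nu r.nd (hubbardOpenBoxTT' a b t t' U₀))).re)
    {s : ℝ} (hs : 2 * Real.binEntropy (n / 2) < s) :
    ω.meanEnergy (hubbardTTPrimeFermionInteraction t t' U) 1 ≤
      (s - (Wnum : ℝ) / Wden) / β + max (U - U₀) 0 * (n / 2) := by
  obtain ⟨hnd, hq, hmS, hsum, hA, hB, hz0, harith⟩ := c2Check_sound hcheck ha hb
  have hn0 : 0 ≤ n := density_nonneg_of_type ha hb hq hn
  have hz := c2Floor_le_of_rows hnd
    (F := fun s => (partitionFn β (spinSectorHamiltonian s.1 s.2 (hubbardOpenBoxTT' a b t t' U₀))).re)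
    (fun r hr => hnode r hr)
  have hcount : ∀ᶠ j in atTop, Real.log (sectorGibbsCount n (Ls j)) ≤ s * (Ls j : ℝ) ^ 2 :=
    hLs.eventually (eventually_log_sectorGibbsCount_le hn0 hn2 hs)
  refine le_of_forall_pos_le_add fun δ hδ => ?_
  have hε : 0 < δ * β := by positivity
  have hfloor : ∀ᶠ j in atTop, ((Wnum : ℝ) / Wden - β * max (U - U₀) 0 * (n / 2) - δ * β) * (Ls j : ℝ) ^ 2 ≤
      Real.log (partitionFn β (sectorHamiltonianTT' t t' U n (Ls j))).re := by
    have h1 := eventually_typeFreeEntropy_mul_sq_le_log_partitionFn_allTori_of_anchorU_kinematic t t' U₀ U n hβ.le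
      ha hb (c2Sectors rows) (c2Type rows) hq hmS hsum hA hB hn hn2 hz0 hz hLs hε
    filter_upwards [h1] with j hj
    exact le_trans (mul_le_mul_of_nonneg_right (by linarith) (sq_nonneg _)) hj
  have h2 := h.meanEnergy_hubbardTTPrime_le_entropy_sub_div_of_sectorGibbs hn0 hn2 hLs hβ hfloor hcount
  have heq : (s - ((Wnum : ℝ) / Wden - β * max (U - U₀) 0 * (n / 2) - δ * β)) / β =
      (s - (Wnum : ℝ) / Wden) / β + max (U - U₀) 0 * (n / 2) + δ := by
    field_simp
    ring
  rw [heq] at h2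
  exact h2

/-- **SELF-PRICED cap above the sidecar**: with a `T = 0` energy floor `f ≤ e(t,t',U₁,n)` at `0 ≤ U₁ < U₀` the docc word
of §4 prices the move, `e_Φ(t,t',U)(ω) ≤ (s − W)/β + (U − U₀)·(s − β f − W)/(β (U₀ − U₁))`, `W = Wnum/Wden`, for every
torus limit at `(β, t, t', U, n)`, every `U ≥ U₀` (`β > 0`, `0 ≤ n < 2`) — ONE sidecar and ONE ground-state floor word
the whole half-line `U ≥ U₀`. [cite: Lieb1973, §V (5.2)–(5.4)] [cite: Israel1979, Lemma II.3.1]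
[cite: GustafsonSigal2003, §18.3] -/
theorem IsTorusLimitOfMixture.meanEnergy_hubbardTTPrime_le_of_c2Check_infT_allTori_of_energyFloor_left_U
    (hn2 : n < 2) {U₁ U₀ : ℝ} (hU₁ : 0 ≤ U₁) (hU₁₀ : U₁ < U₀) (hU : U₀ ≤ U)
    (h : ω.IsTorusLimitOfMixture (sectorGibbsCount n) (fun L => sectorGibbsWeightTT' β t t' U n L)
      (fun L => sectorGibbsVectorTT' t t' U n L) Ls)
    (hLs : Tendsto Ls atTop atTop) (hβ : 0 < β)
    {a b : ℕ} (ha : 1 ≤ a) (hb : 1 ≤ b) {rows : List C2Row} {P K q A₀ : ℕ} {Wnum : ℤ} {Wden : ℕ}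
    (hcheck : c2Check P K q A₀ a b rows Wnum Wden = true) (hn : n * ((q : ℝ) * a * b) = 2 * A₀)
    (hnode : ∀ r ∈ rows,
      r.floor ≤ (partitionFn β (spinSectorHamiltonian r.nu r.nd (hubbardOpenBoxTT' a b t t' U₀))).re)
    {f : ℝ} (hf : f ≤ energyDensityTT' t t' U₁ n) {s : ℝ} (hs : 2 * Real.binEntropy (n / 2) < s) :
    ω.meanEnergy (hubbardTTPrimeFermionInteraction t t' U) 1 ≤
      (s - (Wnum : ℝ) / Wden) / β + (U - U₀) * ((s - β * f - (Wnum : ℝ) / Wden) / (β * (U₀ - U₁))) := by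
  obtain ⟨-, hq, -⟩ := c2Check_sound hcheck ha hb
  have hn0 : 0 ≤ n := density_nonneg_of_type ha hb hq hn
  exact h.meanEnergy_hubbardTTPrime_le_of_c2Check_infT_allTori_of_doccWord_left_U hn2.le hU hLs hβ ha hb hcheck hn
    hnode (fun ω₁ Ls₁ hLs₁ h₁ => h₁.meanEnergy_onSite_le_of_c2Check_right_of_energyFloor_left_U_allTori hn0 hn2 hU₁
      hU₁₀ le_rfl hβ ha hb hcheck hn hnode hf hs hLs₁) hs

/-! ### §6 The lower edge on a `U`-interval from a `T = 0` floor at its left end -/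

/-- **Lower edge on `[U₁, ∞)` from ONE ground-state floor at `U₁`**: `0 ≤ U₁ ≤ U`, `0 ≤ n < 2`, `f ≤ e(t,t',U₁,n)`;
then `f ≤ e_Φ(t,t',U)(ω)` for every torus limit `ω` of the canonical sector Gibbs states at `(β, t, t', U, n)` along any
`Ls → ∞` (the thermal energy is at least the ground-state energy density, which is monotone in `U`).
[cite: Ruelle1969, §3.4] [cite: KomaTasaki1994, §1] -/
theorem IsTorusLimitOfMixture.le_meanEnergy_hubbardTTPrime_of_energyFloor_left_U (hn0 : 0 ≤ n) (hn2 : n < 2)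
    {U₁ : ℝ} (hU₁ : 0 ≤ U₁) (hU : U₁ ≤ U) {f : ℝ} (hf : f ≤ energyDensityTT' t t' U₁ n)
    (h : ω.IsTorusLimitOfMixture (sectorGibbsCount n) (fun L => sectorGibbsWeightTT' β t t' U n L)
      (fun L => sectorGibbsVectorTT' t t' U n L) Ls)
    (hLs : Tendsto Ls atTop atTop) :
    f ≤ ω.meanEnergy (hubbardTTPrimeFermionInteraction t t' U) 1 :=
  (hf.trans (energyDensityTT'_mono_U t t' hn0 hn2 hU₁ hU)).trans
    (h.energyDensityTT'_le_meanEnergy_of_sectorGibbs t t' U hn0 hn2 β hLs t' (hU₁.trans hU))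

/-! ### §7 The `n = 7/8` editions (`s = 1371/1000`) -/

/-- **Thermal docc cap at `n = 7/8` from the sidecar and a `T = 0` floor**:
`D(ω) ≤ (1371/1000 − β f − Wnum/Wden)/(β (U₀ − U₁))` for every torus limit at `(β, t, t', U, 7/8)`, every `U ≥ U₀`.
[cite: Lieb1973, §V (5.2)–(5.4)] [cite: KomaTasaki1994, §1] -/
theorem IsTorusLimitOfMixture.meanEnergy_onSite_le_of_c2Check_right_of_energyFloor_left_U_seven_eighths
    {U₁ U₀ : ℝ} (hU₁ : 0 ≤ U₁) (hU₁₀ : U₁ < U₀) (hU : U₀ ≤ U) (hβ : 0 < β)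
    {a b : ℕ} (ha : 1 ≤ a) (hb : 1 ≤ b) {rows : List C2Row} {P K q A₀ : ℕ} {Wnum : ℤ} {Wden : ℕ}
    (hcheck : c2Check P K q A₀ a b rows Wnum Wden = true) (hn : (7 / 8 : ℝ) * ((q : ℝ) * a * b) = 2 * A₀)
    (hnode : ∀ r ∈ rows,
      r.floor ≤ (partitionFn β (spinSectorHamiltonian r.nu r.nd (hubbardOpenBoxTT' a b t t' U₀))).re)
    {f : ℝ} (hf : f ≤ energyDensityTT' t t' U₁ (7 / 8))
    (h : ω.IsTorusLimitOfMixture (sectorGibbsCount (7 / 8)) (fun L => sectorGibbsWeightTT' β t t' U (7 / 8) L)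
      (fun L => sectorGibbsVectorTT' t t' U (7 / 8) L) Ls)
    (hLs : Tendsto Ls atTop atTop) :
    ω.meanEnergy (hubbardTTPrimeFermionInteraction 0 0 1) 1 ≤
      (1371 / 1000 - β * f - (Wnum : ℝ) / Wden) / (β * (U₀ - U₁)) :=
  h.meanEnergy_onSite_le_of_c2Check_right_of_energyFloor_left_U_allTori (by norm_num) (by norm_num) hU₁ hU₁₀ hU hβ
    ha hb hcheck hn hnode hf two_mul_binEntropy_seven_sixteenths_lt hLs

/-- **Priced cap above the sidecar at `n = 7/8` with any docc word `A` at the sidecar**: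
`e_Φ(t,t',U)(ω) ≤ (1371/1000 − Wnum/Wden)/β + (U − U₀)·A`, every `U ≥ U₀`. [cite: Lieb1973, §V (5.2)–(5.4)]
[cite: Israel1979, Lemma II.3.1] -/
theorem IsTorusLimitOfMixture.meanEnergy_hubbardTTPrime_le_of_c2Check_infT_seven_eighths_of_doccWord_left_U
    {U₀ : ℝ} (hU : U₀ ≤ U)
    (h : ω.IsTorusLimitOfMixture (sectorGibbsCount (7 / 8)) (fun L => sectorGibbsWeightTT' β t t' U (7 / 8) L)
      (fun L => sectorGibbsVectorTT' t t' U (7 / 8) L) Ls)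
    (hLs : Tendsto Ls atTop atTop) (hβ : 0 < β)
    {a b : ℕ} (ha : 1 ≤ a) (hb : 1 ≤ b) {rows : List C2Row} {P K q A₀ : ℕ} {Wnum : ℤ} {Wden : ℕ}
    (hcheck : c2Check P K q A₀ a b rows Wnum Wden = true) (hn : (7 / 8 : ℝ) * ((q : ℝ) * a * b) = 2 * A₀)
    (hnode : ∀ r ∈ rows,
      r.floor ≤ (partitionFn β (spinSectorHamiltonian r.nu r.nd (hubbardOpenBoxTT' a b t t' U₀))).re)
    {A : ℝ}
    (hAw : ∀ (ω₁ : InfVolFermionState 2) (Ls₁ : ℕ → ℕ), Tendsto Ls₁ atTop atTop →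
      ω₁.IsTorusLimitOfMixture (sectorGibbsCount (7 / 8)) (fun L => sectorGibbsWeightTT' β t t' U₀ (7 / 8) L)
        (fun L => sectorGibbsVectorTT' t t' U₀ (7 / 8) L) Ls₁ →
      ω₁.meanEnergy (hubbardTTPrimeFermionInteraction 0 0 1) 1 ≤ A) :
    ω.meanEnergy (hubbardTTPrimeFermionInteraction t t' U) 1 ≤ (1371 / 1000 - (Wnum : ℝ) / Wden) / β + (U - U₀) * A :=
  h.meanEnergy_hubbardTTPrime_le_of_c2Check_infT_allTori_of_doccWord_left_U (by norm_num) hU hLs hβ ha hb hcheck hn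
    hnode hAw two_mul_binEntropy_seven_sixteenths_lt

/-- **Self-priced cap above the sidecar at `n = 7/8`**:
`e_Φ(t,t',U)(ω) ≤ (1371/1000 − W)/β + (U − U₀)·(1371/1000 − β f − W)/(β (U₀ − U₁))`, `W = Wnum/Wden`, every `U ≥ U₀`,
with a `T = 0` floor `f` at `0 ≤ U₁ < U₀`. [cite: Lieb1973, §V (5.2)–(5.4)] [cite: Israel1979, Lemma II.3.1]
[cite: GustafsonSigal2003, §18.3] -/
theorem IsTorusLimitOfMixture.meanEnergy_hubbardTTPrime_le_of_c2Check_infT_seven_eighths_of_energyFloor_left_U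
    {U₁ U₀ : ℝ} (hU₁ : 0 ≤ U₁) (hU₁₀ : U₁ < U₀) (hU : U₀ ≤ U)
    (h : ω.IsTorusLimitOfMixture (sectorGibbsCount (7 / 8)) (fun L => sectorGibbsWeightTT' β t t' U (7 / 8) L)
      (fun L => sectorGibbsVectorTT' t t' U (7 / 8) L) Ls)
    (hLs : Tendsto Ls atTop atTop) (hβ : 0 < β)
    {a b : ℕ} (ha : 1 ≤ a) (hb : 1 ≤ b) {rows : List C2Row} {P K q A₀ : ℕ} {Wnum : ℤ} {Wden : ℕ}
    (hcheck : c2Check P K q A₀ a b rows Wnum Wden = true) (hn : (7 / 8 : ℝ) * ((q : ℝ) * a * b) = 2 * A₀)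
    (hnode : ∀ r ∈ rows,
      r.floor ≤ (partitionFn β (spinSectorHamiltonian r.nu r.nd (hubbardOpenBoxTT' a b t t' U₀))).re)
    {f : ℝ} (hf : f ≤ energyDensityTT' t t' U₁ (7 / 8)) :
    ω.meanEnergy (hubbardTTPrimeFermionInteraction t t' U) 1 ≤
      (1371 / 1000 - (Wnum : ℝ) / Wden) / β +
        (U - U₀) * ((1371 / 1000 - β * f - (Wnum : ℝ) / Wden) / (β * (U₀ - U₁))) :=
  h.meanEnergy_hubbardTTPrime_le_of_c2Check_infT_allTori_of_energyFloor_left_U (by norm_num) hU₁ hU₁₀ hU hLs hβ ha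
    hb hcheck hn hnode hf two_mul_binEntropy_seven_sixteenths_lt


/-! ### §8 (appended) `t' = 0`: BOTH certificates at the sidecar's coupling `U₀` — C2 sidecar at `(β, U₀)` and C1 rectangle Markov
certificate at `(β_h, U₀)` (the hubbard-thermal cells at a fixed point) — worded on a `U`-interval around `U₀`

Below `U₀` the C2 floor is free and the C1 hot ceiling pays the kinematic docc price `β_h (U₀ − U)·n/2`; above `U₀` the C1 ceiling
is free (ceilings move up in `U`) and the C2 floor pays `β (U − U₀)·A` with a thermal docc ceiling word `A` at `(β, U₀)` — kinematic
`n/2`, any certified word, or the sidecar's own word of §4. -/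

/-- **C1 + C2 at ONE anchor `U₀`, the cell at EVERY `U`, kinematic prices** (`t' = 0`, `0 < β_h < β`, `n ≤ 2`): for every torus
limit `ω` of the canonical sector Gibbs states at `(β, t, 0, U, n)` along any `Ls → ∞`,
`e_Φ(ω) ≤ ((c − β_h μ n) + β_h·max(U₀ − U, 0)·n/2 − (Wnum/Wden − β·max(U − U₀, 0)·n/2))/(β − β_h)`
(exactly one `max` is nonzero: below the anchor the hot ceiling pays, above it the cold floor pays). Data: checked sidecar + node at
`(β, t, 0, U₀)` with density `n (q a b) = 2 A₀`; C1 rectangle certificate (`a' × b'`, annihilator, dual `L_B`, constant `c`) at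
`(β_h, μ, U₀)`. [cite: Israel1979, Lemma II.3.1] [cite: Lieb1973, §V (5.2)–(5.4)] [cite: PoulinHastings2011, eqs. (3)–(8)] -/
theorem IsTorusLimitOfMixture.meanEnergy_hubbardTTPrime_le_of_c2Check_of_rectMarkovCertificate_allTori_anchorU_kinematic
    (hn2 : n ≤ 2) (U₀ : ℝ)
    (h : ω.IsTorusLimitOfMixture (sectorGibbsCount n) (fun L => sectorGibbsWeightTT' β t 0 U n L)
      (fun L => sectorGibbsVectorTT' t 0 U n L) Ls)
    (hLs : Tendsto Ls atTop atTop) {βh : ℝ} (hβh : 0 < βh) (hlt : βh < β)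
    -- C2 at `(β, U₀)`
    {a b : ℕ} (ha : 1 ≤ a) (hb : 1 ≤ b) {rows : List C2Row} {P K q A₀ : ℕ} {Wnum : ℤ} {Wden : ℕ}
    (hcheck : c2Check P K q A₀ a b rows Wnum Wden = true) (hn : n * ((q : ℝ) * a * b) = 2 * A₀)
    (hnode : ∀ r ∈ rows,
      r.floor ≤ (partitionFn β (spinSectorHamiltonian r.nu r.nd (hubbardOpenBoxTT' a b t 0 U₀))).re)
    -- C1 at `(βh, U₀)` (`t' = 0`)
    (μ : ℝ) {a' b' : ℕ} (ha' : 2 ≤ a') (hb' : 2 ≤ b')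
    {ι : Type*} (sι : Finset ι) (Sw : ι → Finset (Site 2)) (hS : ∀ i, Sw i ⊆ rectWindow a' b') (zw : ι → Site 2)
    (hzw : ∀ i, shiftSet (zw i) (Sw i) ⊆ rectWindow a' b') {O : ∀ i, FermionOp (Sw i)}
    (hO : ∀ i ∈ sι, (O i).IsHermitian) (g : ι → ℝ)
    {LB : FermionOp ((rectWindow a' b').erase (mkSite2 (a' - 1) (b' - 1)))} (hLB : LB.IsHermitian) {c : ℝ}
    (hcert : ((Real.exp c : ℂ) • cfc Real.exp LB -
      fermionPartialTrace (PolySite.incl (Finset.erase_subset (mkSite2 (a' - 1) (b' - 1)) (rectWindow a' b')))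
        (cfc Real.exp (-((βh : ℂ) • (cornerEnergyRep (rectWindow a' b') (mkSite2 (a' - 1) (b' - 1)) t U₀ μ +
            windowAnnihilator sι (rectWindow a' b') Sw hS zw hzw O g)) +
          fermionEmbed (PolySite.incl (Finset.erase_subset (mkSite2 (a' - 1) (b' - 1)) (rectWindow a' b'))) LB))).PosSemidef) :
    ω.meanEnergy (hubbardTTPrimeFermionInteraction t 0 U) 1 ≤
      ((c - βh * μ * n) + βh * max (U₀ - U) 0 * (n / 2) -
        ((Wnum : ℝ) / Wden - β * max (U - U₀) 0 * (n / 2))) / (β - βh) := by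
  obtain ⟨-, hq, -⟩ := c2Check_sound hcheck ha hb
  have hn0 : 0 ≤ n := density_nonneg_of_type ha hb hq hn
  have hβ : 0 ≤ β := (hβh.trans hlt).le
  have hKTI : ∀ (L : ℕ) [NeZero L], ∀ w : TorusSite 2 L,
      relabel (Orb.translate w) (hubbardTorusTT' L t 0 U₀ - (μ : ℂ) • totalNumber) =
        hubbardTorusTT' L t 0 U₀ - (μ : ℂ) • totalNumber := fun L _ w => by
    rw [hubbardTorusTT'_zero_sub_mu, relabel_translate_hubbardTorusWith]
  have hu : ∀ (Ls' : ℕ → ℕ), Tendsto Ls' atTop atTop → ∀ ε : ℝ, 0 < ε → ∀ᶠ j in atTop,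
      Real.log (partitionFn βh (sectorHamiltonianTT' t 0 U₀ n (Ls' j))).re ≤ ((c - βh * μ * n) + ε) * (Ls' j : ℝ) ^ 2 :=
    fun Ls' hLs' ε hε => eventually_log_partitionFn_sectorHamiltonianTT'_le_of_clusterCertificate t U₀ μ βh hn0 hn2 hLs'
      (rectCorner_mem_rectWindow (by omega) (by omega)) toLex_le_toLex_rectCorner
      (rectWindow_subset_halfOpenBox_max a' b')
      (fun i => bondWeightSum_cornerBondWeight (rectCorner_mem_rectWindow (by omega) (by omega))
        (rectCorner_sub_unitVec_mem_rectWindow ha' hb' i))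
      (siteWeightSum_cornerSiteWeight (rectCorner_mem_rectWindow (by omega) (by omega)))
      (siteWeightSum_mul_cornerSiteWeight (rectCorner_mem_rectWindow (by omega) (by omega)) (-μ))
      (isHermitian_windowAnnihilator sι _ Sw hS zw hzw hO g)
      (fun L _ hL3 hℓL => trace_window_mul_windowAnnihilator (relabel_translate_gibbsDensity L (hKTI L) βh)
        _ sι Sw hS zw hzw O g) hLB hcert hε
  exact h.meanEnergy_hubbardTTPrime_le_of_pressure_bounds_anchorU_kinematic hn0 hn2 U₀ hLs hβh hlt
    (fun ε hε => eventually_pressureFloor_of_c2Check_of_le_U t 0 n le_rfl hβ ha hb hcheck hn hn2 hnode hLs hε)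
    (hu Ls hLs)

/-- **C1 + C2 at the anchor `U₀`, the cell at every `U ≥ U₀` priced by a thermal docc ceiling word `A` at `(β, U₀)`** (`t' = 0`,
`0 < β_h < β`, `n ≤ 2`; `A` valid for every torus limit at `(β, t, 0, U₀, n)` along every `Ls → ∞`):
`e_Φ(ω) ≤ ((c − β_h μ n) − (Wnum/Wden − β (U − U₀) A))/(β − β_h)` for every torus limit at `(β, t, 0, U, n)` — the C1 ceiling
moves up in `U` for free, the C2 floor pays `β (U − U₀) A`. [cite: Israel1979, Lemma II.3.1] [cite: Lieb1973, §V (5.2)–(5.4)]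
[cite: PoulinHastings2011, eqs. (3)–(8)] -/
theorem IsTorusLimitOfMixture.meanEnergy_hubbardTTPrime_le_of_c2Check_of_rectMarkovCertificate_allTori_of_doccWord_left_U
    (hn2 : n ≤ 2) {U₀ : ℝ} (hU : U₀ ≤ U)
    (h : ω.IsTorusLimitOfMixture (sectorGibbsCount n) (fun L => sectorGibbsWeightTT' β t 0 U n L)
      (fun L => sectorGibbsVectorTT' t 0 U n L) Ls)
    (hLs : Tendsto Ls atTop atTop) {βh : ℝ} (hβh : 0 < βh) (hlt : βh < β)
    -- C2 at `(β, U₀)`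
    {a b : ℕ} (ha : 1 ≤ a) (hb : 1 ≤ b) {rows : List C2Row} {P K q A₀ : ℕ} {Wnum : ℤ} {Wden : ℕ}
    (hcheck : c2Check P K q A₀ a b rows Wnum Wden = true) (hn : n * ((q : ℝ) * a * b) = 2 * A₀)
    (hnode : ∀ r ∈ rows,
      r.floor ≤ (partitionFn β (spinSectorHamiltonian r.nu r.nd (hubbardOpenBoxTT' a b t 0 U₀))).re)
    {A : ℝ}
    (hAw : ∀ (ω₁ : InfVolFermionState 2) (Ls₁ : ℕ → ℕ), Tendsto Ls₁ atTop atTop →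
      ω₁.IsTorusLimitOfMixture (sectorGibbsCount n) (fun L => sectorGibbsWeightTT' β t 0 U₀ n L)
        (fun L => sectorGibbsVectorTT' t 0 U₀ n L) Ls₁ →
      ω₁.meanEnergy (hubbardTTPrimeFermionInteraction 0 0 1) 1 ≤ A)
    -- C1 at `(βh, U₀)` (`t' = 0`)
    (μ : ℝ) {a' b' : ℕ} (ha' : 2 ≤ a') (hb' : 2 ≤ b')
    {ι : Type*} (sι : Finset ι) (Sw : ι → Finset (Site 2)) (hS : ∀ i, Sw i ⊆ rectWindow a' b') (zw : ι → Site 2)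
    (hzw : ∀ i, shiftSet (zw i) (Sw i) ⊆ rectWindow a' b') {O : ∀ i, FermionOp (Sw i)}
    (hO : ∀ i ∈ sι, (O i).IsHermitian) (g : ι → ℝ)
    {LB : FermionOp ((rectWindow a' b').erase (mkSite2 (a' - 1) (b' - 1)))} (hLB : LB.IsHermitian) {c : ℝ}
    (hcert : ((Real.exp c : ℂ) • cfc Real.exp LB -
      fermionPartialTrace (PolySite.incl (Finset.erase_subset (mkSite2 (a' - 1) (b' - 1)) (rectWindow a' b')))
        (cfc Real.exp (-((βh : ℂ) • (cornerEnergyRep (rectWindow a' b') (mkSite2 (a' - 1) (b' - 1)) t U₀ μ +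
            windowAnnihilator sι (rectWindow a' b') Sw hS zw hzw O g)) +
          fermionEmbed (PolySite.incl (Finset.erase_subset (mkSite2 (a' - 1) (b' - 1)) (rectWindow a' b'))) LB))).PosSemidef) :
    ω.meanEnergy (hubbardTTPrimeFermionInteraction t 0 U) 1 ≤
      ((c - βh * μ * n) - ((Wnum : ℝ) / Wden - β * (U - U₀) * A)) / (β - βh) := by
  obtain ⟨hnd, hq, hmS, hsum, hA, hB, hz0, harith⟩ := c2Check_sound hcheck ha hb
  have hn0 : 0 ≤ n := density_nonneg_of_type ha hb hq hn
  have hβpos : 0 < β := hβh.trans hlt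
  have hz := c2Floor_le_of_rows hnd
    (F := fun s => (partitionFn β (spinSectorHamiltonian s.1 s.2 (hubbardOpenBoxTT' a b t 0 U₀))).re)
    (fun r hr => hnode r hr)
  have hKTI : ∀ (L : ℕ) [NeZero L], ∀ w : TorusSite 2 L,
      relabel (Orb.translate w) (hubbardTorusTT' L t 0 U₀ - (μ : ℂ) • totalNumber) =
        hubbardTorusTT' L t 0 U₀ - (μ : ℂ) • totalNumber := fun L _ w => by
    rw [hubbardTorusTT'_zero_sub_mu, relabel_translate_hubbardTorusWith]
  have hu : ∀ (Ls' : ℕ → ℕ), Tendsto Ls' atTop atTop → ∀ ε : ℝ, 0 < ε → ∀ᶠ j in atTop,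
      Real.log (partitionFn βh (sectorHamiltonianTT' t 0 U₀ n (Ls' j))).re ≤ ((c - βh * μ * n) + ε) * (Ls' j : ℝ) ^ 2 :=
    fun Ls' hLs' ε hε => eventually_log_partitionFn_sectorHamiltonianTT'_le_of_clusterCertificate t U₀ μ βh hn0 hn2 hLs'
      (rectCorner_mem_rectWindow (by omega) (by omega)) toLex_le_toLex_rectCorner
      (rectWindow_subset_halfOpenBox_max a' b')
      (fun i => bondWeightSum_cornerBondWeight (rectCorner_mem_rectWindow (by omega) (by omega))
        (rectCorner_sub_unitVec_mem_rectWindow ha' hb' i))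
      (siteWeightSum_cornerSiteWeight (rectCorner_mem_rectWindow (by omega) (by omega)))
      (siteWeightSum_mul_cornerSiteWeight (rectCorner_mem_rectWindow (by omega) (by omega)) (-μ))
      (isHermitian_windowAnnihilator sι _ Sw hS zw hzw hO g)
      (fun L _ hL3 hℓL => trace_window_mul_windowAnnihilator (relabel_translate_gibbsDensity L (hKTI L) βh)
        _ sι Sw hS zw hzw O g) hLB hcert hε
  refine h.meanEnergy_hubbardTTPrime_le_of_eventually_pressure_bounds hn0 hn2 hLs hβh hlt (fun ε hε => ?_)
    (fun ε hε => eventually_log_partitionFn_sectorHamiltonianTT'_le_fun_of_le_U hn0 hn2 t 0 hβh.le hU hLs (hu Ls hLs ε hε))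
  have h1 := eventually_typeFreeEntropy_mul_sq_le_log_partitionFn_allTori_of_doccWord_left_U t 0 n hU hβpos ha hb
    (c2Sectors rows) (c2Type rows) hq hmS hsum hA hB hn hn2 hz0 hz hAw hLs hε
  filter_upwards [h1] with j hj
  exact le_trans (mul_le_mul_of_nonneg_right (by linarith) (sq_nonneg _)) hj

/-- **C1 + C2 at the anchor `U₀`, the cell at every `U ≥ U₀`, SELF-PRICED**: with a `T = 0` floor `f ≤ e(t,0,U₁,n)` at
`0 ≤ U₁ < U₀` the sidecar's own docc word of §4 prices the move:
`e_Φ(ω) ≤ ((c − β_h μ n) − (W − β (U − U₀)·(s − β f − W)/(β (U₀ − U₁))))/(β − β_h)`, `W = Wnum/Wden` (`0 ≤ n < 2`, `s > 2 H_b(n/2)`).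
[cite: Israel1979, Lemma II.3.1] [cite: Lieb1973, §V (5.2)–(5.4)] [cite: PoulinHastings2011, eqs. (3)–(8)] [cite: GustafsonSigal2003, §18.3] -/
theorem IsTorusLimitOfMixture.meanEnergy_hubbardTTPrime_le_of_c2Check_of_rectMarkovCertificate_allTori_of_energyFloor_left_U
    (hn2 : n < 2) {U₁ U₀ : ℝ} (hU₁ : 0 ≤ U₁) (hU₁₀ : U₁ < U₀) (hU : U₀ ≤ U)
    (h : ω.IsTorusLimitOfMixture (sectorGibbsCount n) (fun L => sectorGibbsWeightTT' β t 0 U n L)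
      (fun L => sectorGibbsVectorTT' t 0 U n L) Ls)
    (hLs : Tendsto Ls atTop atTop) {βh : ℝ} (hβh : 0 < βh) (hlt : βh < β)
    -- C2 at `(β, U₀)`
    {a b : ℕ} (ha : 1 ≤ a) (hb : 1 ≤ b) {rows : List C2Row} {P K q A₀ : ℕ} {Wnum : ℤ} {Wden : ℕ}
    (hcheck : c2Check P K q A₀ a b rows Wnum Wden = true) (hn : n * ((q : ℝ) * a * b) = 2 * A₀)
    (hnode : ∀ r ∈ rows,
      r.floor ≤ (partitionFn β (spinSectorHamiltonian r.nu r.nd (hubbardOpenBoxTT' a b t 0 U₀))).re)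
    {f : ℝ} (hf : f ≤ energyDensityTT' t 0 U₁ n) {s : ℝ} (hs : 2 * Real.binEntropy (n / 2) < s)
    -- C1 at `(βh, U₀)` (`t' = 0`)
    (μ : ℝ) {a' b' : ℕ} (ha' : 2 ≤ a') (hb' : 2 ≤ b')
    {ι : Type*} (sι : Finset ι) (Sw : ι → Finset (Site 2)) (hS : ∀ i, Sw i ⊆ rectWindow a' b') (zw : ι → Site 2)
    (hzw : ∀ i, shiftSet (zw i) (Sw i) ⊆ rectWindow a' b') {O : ∀ i, FermionOp (Sw i)}
    (hO : ∀ i ∈ sι, (O i).IsHermitian) (g : ι → ℝ)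
    {LB : FermionOp ((rectWindow a' b').erase (mkSite2 (a' - 1) (b' - 1)))} (hLB : LB.IsHermitian) {c : ℝ}
    (hcert : ((Real.exp c : ℂ) • cfc Real.exp LB -
      fermionPartialTrace (PolySite.incl (Finset.erase_subset (mkSite2 (a' - 1) (b' - 1)) (rectWindow a' b')))
        (cfc Real.exp (-((βh : ℂ) • (cornerEnergyRep (rectWindow a' b') (mkSite2 (a' - 1) (b' - 1)) t U₀ μ +
            windowAnnihilator sι (rectWindow a' b') Sw hS zw hzw O g)) +
          fermionEmbed (PolySite.incl (Finset.erase_subset (mkSite2 (a' - 1) (b' - 1)) (rectWindow a' b'))) LB))).PosSemidef) :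
    ω.meanEnergy (hubbardTTPrimeFermionInteraction t 0 U) 1 ≤
      ((c - βh * μ * n) - ((Wnum : ℝ) / Wden -
        β * (U - U₀) * ((s - β * f - (Wnum : ℝ) / Wden) / (β * (U₀ - U₁))))) / (β - βh) := by
  obtain ⟨-, hq, -⟩ := c2Check_sound hcheck ha hb
  have hn0 : 0 ≤ n := density_nonneg_of_type ha hb hq hn
  have hβpos : 0 < β := hβh.trans hlt
  exact h.meanEnergy_hubbardTTPrime_le_of_c2Check_of_rectMarkovCertificate_allTori_of_doccWord_left_U hn2.le hU hLs hβh hlt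
    ha hb hcheck hn hnode
    (fun ω₁ Ls₁ hLs₁ h₁ => h₁.meanEnergy_onSite_le_of_c2Check_right_of_energyFloor_left_U_allTori hn0 hn2 hU₁ hU₁₀ le_rfl
      hβpos ha hb hcheck hn hnode hf hs hLs₁)
    μ ha' hb' sι Sw hS zw hzw hO g hLB hcert

/-- **`n = 7/8` edition of the self-priced C1 + C2 cell above the anchor** (`s = 1371/1000`).
[cite: Israel1979, Lemma II.3.1] [cite: Lieb1973, §V (5.2)–(5.4)] [cite: PoulinHastings2011, eqs. (3)–(8)] -/
theorem IsTorusLimitOfMixture.meanEnergy_hubbardTTPrime_le_of_c2Check_of_rectMarkovCertificate_allTori_seven_eighths_of_energyFloor_left_U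
    {U₁ U₀ : ℝ} (hU₁ : 0 ≤ U₁) (hU₁₀ : U₁ < U₀) (hU : U₀ ≤ U)
    (h : ω.IsTorusLimitOfMixture (sectorGibbsCount (7 / 8)) (fun L => sectorGibbsWeightTT' β t 0 U (7 / 8) L)
      (fun L => sectorGibbsVectorTT' t 0 U (7 / 8) L) Ls)
    (hLs : Tendsto Ls atTop atTop) {βh : ℝ} (hβh : 0 < βh) (hlt : βh < β)
    -- C2 at `(β, U₀)`
    {a b : ℕ} (ha : 1 ≤ a) (hb : 1 ≤ b) {rows : List C2Row} {P K q A₀ : ℕ} {Wnum : ℤ} {Wden : ℕ}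
    (hcheck : c2Check P K q A₀ a b rows Wnum Wden = true) (hn : (7 / 8 : ℝ) * ((q : ℝ) * a * b) = 2 * A₀)
    (hnode : ∀ r ∈ rows,
      r.floor ≤ (partitionFn β (spinSectorHamiltonian r.nu r.nd (hubbardOpenBoxTT' a b t 0 U₀))).re)
    {f : ℝ} (hf : f ≤ energyDensityTT' t 0 U₁ (7 / 8))
    -- C1 at `(βh, U₀)` (`t' = 0`)
    (μ : ℝ) {a' b' : ℕ} (ha' : 2 ≤ a') (hb' : 2 ≤ b')
    {ι : Type*} (sι : Finset ι) (Sw : ι → Finset (Site 2)) (hS : ∀ i, Sw i ⊆ rectWindow a' b') (zw : ι → Site 2)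
    (hzw : ∀ i, shiftSet (zw i) (Sw i) ⊆ rectWindow a' b') {O : ∀ i, FermionOp (Sw i)}
    (hO : ∀ i ∈ sι, (O i).IsHermitian) (g : ι → ℝ)
    {LB : FermionOp ((rectWindow a' b').erase (mkSite2 (a' - 1) (b' - 1)))} (hLB : LB.IsHermitian) {c : ℝ}
    (hcert : ((Real.exp c : ℂ) • cfc Real.exp LB -
      fermionPartialTrace (PolySite.incl (Finset.erase_subset (mkSite2 (a' - 1) (b' - 1)) (rectWindow a' b')))
        (cfc Real.exp (-((βh : ℂ) • (cornerEnergyRep (rectWindow a' b') (mkSite2 (a' - 1) (b' - 1)) t U₀ μ +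
            windowAnnihilator sι (rectWindow a' b') Sw hS zw hzw O g)) +
          fermionEmbed (PolySite.incl (Finset.erase_subset (mkSite2 (a' - 1) (b' - 1)) (rectWindow a' b'))) LB))).PosSemidef) :
    ω.meanEnergy (hubbardTTPrimeFermionInteraction t 0 U) 1 ≤
      ((c - βh * μ * (7 / 8)) - ((Wnum : ℝ) / Wden -
        β * (U - U₀) * ((1371 / 1000 - β * f - (Wnum : ℝ) / Wden) / (β * (U₀ - U₁))))) / (β - βh) :=
  h.meanEnergy_hubbardTTPrime_le_of_c2Check_of_rectMarkovCertificate_allTori_of_energyFloor_left_U (by norm_num) hU₁ hU₁₀ hU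
    hLs hβh hlt ha hb hcheck hn hnode hf two_mul_binEntropy_seven_sixteenths_lt μ ha' hb' sι Sw hS zw hzw hO g hLB hcert

end InfVolFermionState

end Literature.MathematicalPhysics.QuantumLattice

end
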